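import Mathlib
import Summits.ValiantsHypothesis.ValiantsHypothesis.Theorems.ContractivityPricePriceOfContractivityStubOneLargeClassBounds
import HarnessLib

/-!
# Crux `PriceOfContractivity` (stmt-ValiantsHypothesis-10583), line `registered` (birth rev 10) —
# piece `piece3_coeffBound` (W3: coefficient bound for margin-2 zero-free polynomials)

Route `ValiantsHypothesis/ContractivityPrice`, crux K1
(`Summit.ValiantsHypothesis.ValiantsHypothesis.Theses.ContractivityPrice.PriceOfContractivity`),
registered partial case `stub_stableLifting_fewColours` (♦ for few colour classes, Theorem A″),
piece (W3) of its proof.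

**Statement.** Let `q : MvPolynomial ι ℂ` (`ι` finite) have total degree `≤ t` (`t ≥ 1`),
`q(0) = 1`, and no zero on the closed polydisc of radius `2`.  Then every coefficient satisfies
`‖coeff α q‖ ≤ 3 · (t/2) ^ |α|`.

**Proof.** (i) Sup bound on the small polydisc of radius `ρ := 2/t`: for `‖w‖_∞ ≤ ρ` the slice
`g(s) := q(s w)` is a univariate polynomial of degree `≤ t` with `g(0) = 1` and no zero in the
closed disc `|s| ≤ t` (because `‖s w‖_∞ ≤ 2`).  Factoring `g = c ∏ (s - sᵢ)` over `ℂ` with all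
`|sᵢ| > t` and `|c| ∏ |sᵢ| = |g(0)| = 1` gives
`|q(w)| = |g(1)| ≤ ∏ (1 + 1/|sᵢ|) · |c| ∏ |sᵢ| ≤ (1 + 1/t)^t ≤ e ≤ 3`.
(ii) Cauchy's estimate on the torus of radius `ρ`: `‖coeff α q‖ ≤ 3 / ρ^{|α|}`, by induction on
the number of variables (`MvPolynomial.finSuccEquiv`) from the univariate estimate
`piece_c_cauchy` (landed, `…StubOneLargeClassBounds`).  With `ρ = 2/t` this is the claim.
All folklore; no definitions.
-/

noncomputable section

-- `Summit.<Summit>.<Problem>` repeats `ValiantsHypothesis` by the tree's layout convention (D-0017).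
set_option linter.dupNamespace false

namespace Summit.ValiantsHypothesis.ValiantsHypothesis.Theorems.PriceOfContractivity.FewColours

open Summit.ValiantsHypothesis.ValiantsHypothesis.Theorems.PriceOfContractivity.OneLargeClass
  (piece_c_cauchy)
open Summit.ValiantsHypothesis.ValiantsHypothesis.Theorems.PriceOfContractivity.MonochromeBlocks
  (exists_enum_of_card_eq)

/-! ### (i) The univariate slice bound -/

/-- If a complex polynomial `g` has `g(0) = 1` and no zero in the closed disc of radius `R > 0`,
then `‖g(1)‖ ≤ (1 + 1/R) ^ deg g`: factor `g = c ∏ (X - sᵢ)` with `|sᵢ| > R`,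
`|c| ∏ |sᵢ| = 1` and `|1 - sᵢ| ≤ |sᵢ| (1 + 1/R)`. [folklore] -/
theorem norm_eval_one_le_pow (g : Polynomial ℂ) (R : ℝ) (hR : 0 < R) (h0 : g.eval 0 = 1)
    (hz : ∀ s : ℂ, ‖s‖ ≤ R → g.eval s ≠ 0) :
    ‖g.eval 1‖ ≤ (1 + 1 / R) ^ g.natDegree := by
  have hs : g.Splits := IsAlgClosed.splits g
  obtain ⟨d, hd⟩ := exists_enum_of_card_eq (m := Fin g.roots.card) g.roots (by simp)
  have hev : ∀ s : ℂ, g.eval s = g.leadingCoeff * ∏ i, (s - d i) := fun s => by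
    rw [hs.eval_eq_prod_roots, hd fun a => s - a]
  have hN : g.natDegree = g.roots.card := hs.natDegree_eq_card_roots
  -- the roots lie outside the closed disc
  have hdi : ∀ i, R < ‖d i‖ := by
    intro i
    by_contra hle
    rw [not_lt] at hle
    refine hz (d i) hle ?_
    rw [hev]
    exact mul_eq_zero_of_right _ (Finset.prod_eq_zero (Finset.mem_univ i) (sub_self _))
  have h1 : ‖g.leadingCoeff‖ * ∏ i, ‖d i‖ = 1 := by
    have h := congrArg (fun z : ℂ => ‖z‖) (hev 0)
    simp only [h0, norm_one, norm_mul, norm_prod, zero_sub, norm_neg] at h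
    exact h.symm
  rw [hev 1, norm_mul, norm_prod, hN]
  calc ‖g.leadingCoeff‖ * ∏ i, ‖1 - d i‖
      ≤ ‖g.leadingCoeff‖ * ∏ i, (‖d i‖ * (1 + 1 / R)) := by
        refine mul_le_mul_of_nonneg_left ?_ (norm_nonneg _)
        refine Finset.prod_le_prod (fun i _ => norm_nonneg _) fun i _ => ?_
        have h1R : 1 ≤ ‖d i‖ / R := by
          rw [le_div_iff₀ hR, one_mul]
          exact (hdi i).le
        calc ‖1 - d i‖ ≤ ‖(1 : ℂ)‖ + ‖d i‖ := norm_sub_le _ _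
          _ ≤ ‖d i‖ / R + ‖d i‖ := by rw [norm_one]; linarith
          _ = ‖d i‖ * (1 + 1 / R) := by ring
    _ = (‖g.leadingCoeff‖ * ∏ i, ‖d i‖) * (1 + 1 / R) ^ g.roots.card := by
        rw [Finset.prod_mul_distrib, Finset.prod_const, Finset.card_univ, Fintype.card_fin]
        ring
    _ = (1 + 1 / R) ^ g.roots.card := by rw [h1, one_mul]

/-- `(1 + 1/t)^t ≤ e ≤ 3` for `t ≥ 1`. [folklore] -/
theorem one_add_inv_pow_le_three (t : ℕ) (ht : 1 ≤ t) : (1 + 1 / (t : ℝ)) ^ t ≤ 3 := by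
  have ht0 : (0 : ℝ) < t := by exact_mod_cast ht
  have h1 : 1 + 1 / (t : ℝ) ≤ Real.exp (1 / (t : ℝ)) := by
    have := Real.add_one_le_exp (1 / (t : ℝ)); linarith
  calc (1 + 1 / (t : ℝ)) ^ t ≤ (Real.exp (1 / (t : ℝ))) ^ t :=
        pow_le_pow_left₀ (by positivity) h1 t
    _ = Real.exp (t * (1 / (t : ℝ))) := (Real.exp_nat_mul _ t).symm
    _ = Real.exp 1 := by rw [mul_one_div_cancel ht0.ne']
    _ ≤ 3 := by linarith [Real.exp_one_lt_d9]

/-- **Sup bound on the small polydisc.** If `q` has total degree `≤ t` (`t ≥ 1`), `q(0) = 1` and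
no zero on the closed polydisc of radius `2`, then `‖q(w)‖ ≤ 3` whenever `‖w‖_∞ ≤ 2/t`: the slice
`s ↦ q(s w)` has degree `≤ t`, value `1` at `0` and no zero in `|s| ≤ t`. [folklore] -/
theorem norm_eval_le_three {ι : Type} [Fintype ι] (q : MvPolynomial ι ℂ) (t : ℕ) (ht : 1 ≤ t)
    (hdeg : q.totalDegree ≤ t) (h0 : MvPolynomial.eval (0 : ι → ℂ) q = 1)
    (hz : ∀ z : ι → ℂ, (∀ j, ‖z j‖ ≤ 2) → MvPolynomial.eval z q ≠ 0)
    (w : ι → ℂ) (hw : ∀ j, ‖w j‖ ≤ 2 / t) : ‖MvPolynomial.eval w q‖ ≤ 3 := by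
  classical
  have ht0 : (0 : ℝ) < t := by exact_mod_cast ht
  -- the slice polynomial `g(s) = q(s w)`
  obtain ⟨g, hg⟩ : ∃ g : Polynomial ℂ, g = ∑ β ∈ q.support,
      Polynomial.C (q.coeff β * ∏ j, w j ^ β j) * Polynomial.X ^ β.degree := ⟨_, rfl⟩
  have hgev : ∀ s : ℂ, g.eval s = MvPolynomial.eval (fun j => s * w j) q := by
    intro s
    rw [hg, Polynomial.eval_finsetSum, MvPolynomial.eval_eq']
    refine Finset.sum_congr rfl fun β _ => ?_
    simp only [Polynomial.eval_mul, Polynomial.eval_C, Polynomial.eval_pow, Polynomial.eval_X,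
      mul_pow, Finset.prod_mul_distrib, Finset.prod_pow_eq_pow_sum, Finsupp.degree_eq_sum]
    ring
  have hgdeg : g.natDegree ≤ t := by
    rw [hg]
    refine Polynomial.natDegree_sum_le_of_forall_le _ _ fun β hβ => ?_
    exact (Polynomial.natDegree_C_mul_X_pow_le _ _).trans
      ((MvPolynomial.le_totalDegree hβ).trans hdeg)
  have hg0 : g.eval 0 = 1 := by
    have h00 : (fun j => (0 : ℂ) * w j) = 0 := funext fun j => zero_mul (w j)
    rw [hgev, h00, h0]
  have hgz : ∀ s : ℂ, ‖s‖ ≤ t → g.eval s ≠ 0 := by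
    intro s hs
    rw [hgev]
    refine hz _ fun j => ?_
    show ‖s * w j‖ ≤ 2
    rw [norm_mul]
    calc ‖s‖ * ‖w j‖ ≤ t * (2 / t) := mul_le_mul hs (hw j) (norm_nonneg _) ht0.le
      _ = 2 := by field_simp
  have hw1 : MvPolynomial.eval w q = g.eval 1 := by
    rw [hgev]
    simp
  rw [hw1]
  refine (norm_eval_one_le_pow g t ht0 hg0 hgz).trans ?_
  calc (1 + 1 / (t : ℝ)) ^ g.natDegree ≤ (1 + 1 / (t : ℝ)) ^ t :=
        pow_le_pow_right₀ (by simp only [le_add_iff_nonneg_right]; positivity) hgdeg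
    _ ≤ 3 := one_add_inv_pow_le_three t ht

/-! ### (ii) Cauchy's estimate on the polydisc -/

/-- **Cauchy's estimate on the polydisc, `Fin n` variables.** If `‖q(w)‖ ≤ S` whenever
`‖w‖_∞ ≤ ρ` (`ρ > 0`), then `‖coeff α q‖ ≤ S / ρ ^ |α|`; induction on `n`, peeling off the
variable `0` with `MvPolynomial.finSuccEquiv` and the univariate estimate `piece_c_cauchy`.
[folklore] -/
theorem norm_coeff_le_fin (ρ : ℝ) (hρ : 0 < ρ) :
    ∀ (n : ℕ) (q : MvPolynomial (Fin n) ℂ) (S : ℝ),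
      (∀ w : Fin n → ℂ, (∀ j, ‖w j‖ ≤ ρ) → ‖MvPolynomial.eval w q‖ ≤ S) →
      ∀ α : Fin n →₀ ℕ, ‖q.coeff α‖ ≤ S / ρ ^ α.degree := by
  intro n
  induction n with
  | zero =>
      intro q S hS α
      obtain rfl : α = 0 := Subsingleton.elim _ _
      have h := hS 0 fun j => Fin.elim0 j
      rw [MvPolynomial.eq_C_of_isEmpty q, MvPolynomial.eval_C] at h
      simpa using h
  | succ n ih =>
      intro q S hS α
      -- `coeff α q = coeff (tail α) (P.coeff (α 0))`, `P := finSuccEquiv q`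
      have hcoeff : q.coeff α =
          ((MvPolynomial.finSuccEquiv ℂ n q).coeff (α 0)).coeff α.tail := by
        rw [MvPolynomial.finSuccEquiv_coeff_coeff, Finsupp.cons_tail]
      -- the coefficient polynomial is bounded by `S / ρ ^ (α 0)` on the polydisc
      have hQ : ∀ w : Fin n → ℂ, (∀ j, ‖w j‖ ≤ ρ) →
          ‖MvPolynomial.eval w ((MvPolynomial.finSuccEquiv ℂ n q).coeff (α 0))‖ ≤
            S / ρ ^ (α 0) := by
        intro w hw
        rw [← Polynomial.coeff_map]
        refine piece_c_cauchy _ ρ S hρ (fun ξ hξ => ?_) (α 0)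
        rw [← MvPolynomial.eval_eq_eval_mv_eval']
        refine hS _ fun j => Fin.cases ?_ (fun k => ?_) j
        · simpa using hξ
        · simpa using hw k
      rw [hcoeff]
      refine (ih _ _ hQ α.tail).trans_eq ?_
      rw [div_div, ← pow_add]
      congr 2
      rw [Finsupp.degree_eq_sum, Finsupp.degree_eq_sum, Fin.sum_univ_succ]
      simp [Finsupp.tail_apply]

/-- **Cauchy's estimate on the polydisc.** If `‖q(w)‖ ≤ S` whenever `‖w‖_∞ ≤ ρ` (`ρ > 0`), then
`‖coeff α q‖ ≤ S / ρ ^ |α|` (transport to `Fin n` variables by `MvPolynomial.rename`).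
[folklore] -/
theorem norm_coeff_le {ι : Type} [Fintype ι] (q : MvPolynomial ι ℂ) (ρ S : ℝ) (hρ : 0 < ρ)
    (hS : ∀ w : ι → ℂ, (∀ j, ‖w j‖ ≤ ρ) → ‖MvPolynomial.eval w q‖ ≤ S) (α : ι →₀ ℕ) :
    ‖q.coeff α‖ ≤ S / ρ ^ α.degree := by
  classical
  have h := norm_coeff_le_fin ρ hρ (Fintype.card ι)
    (MvPolynomial.rename (Fintype.equivFin ι) q) S ?_ (α.mapDomain (Fintype.equivFin ι))
  · rwa [MvPolynomial.coeff_rename_mapDomain _ (Fintype.equivFin ι).injective,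
      Finsupp.degree_mapDomain] at h
  · intro w hw
    rw [MvPolynomial.eval_rename]
    exact hS _ fun j => hw _

/-! ### The piece -/

/-- **Piece (W3): coefficient bound for margin-2 zero-free polynomials.** If
`q : MvPolynomial ι ℂ` has total degree `≤ t` (`t ≥ 1`), `q(0) = 1`, and no zero on the closed
polydisc of radius `2`, then `‖coeff α q‖ ≤ 3 · (t/2) ^ |α|` for every `α` (sup bound `3` on the
polydisc of radius `2/t` by slicing, then Cauchy's estimate on that torus). [folklore] -/
theorem piece3_coeffBound :
    ∀ {ι : Type} [Fintype ι] [DecidableEq ι] (q : MvPolynomial ι ℂ) (t : ℕ), 1 ≤ t →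
      q.totalDegree ≤ t → MvPolynomial.eval (0 : ι → ℂ) q = 1 →
      (∀ z : ι → ℂ, (∀ j, ‖z j‖ ≤ 2) → MvPolynomial.eval z q ≠ 0) →
      ∀ α : ι →₀ ℕ, ‖q.coeff α‖ ≤ 3 * ((t : ℝ) / 2) ^ α.degree := by
  intro ι _ _ q t ht hdeg h0 hz α
  have ht0 : (0 : ℝ) < t := by exact_mod_cast ht
  have hρ : (0 : ℝ) < 2 / t := by positivity
  have h := norm_coeff_le q (2 / t) 3 hρ
    (fun w hw => norm_eval_le_three q t ht hdeg h0 hz w hw) α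
  rwa [div_eq_mul_inv, ← inv_pow, inv_div] at h

end Summit.ValiantsHypothesis.ValiantsHypothesis.Theorems.PriceOfContractivity.FewColours
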